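import Summits.ABC.ABC.Theses.IneffectiveSubspace
import Summits.ABC.ABC.Theorems.IneffectiveSubspaceAbcGivesUniformSadic
import Summits.ABC.ABC.Theorems.IneffectiveSubspaceUniformSadicGivesTowerFour

/-!
# The Pell-square cell `1 + t² = m·n⁴` and the quartic-root wall `W₄` (stmt-ABC-14937)

Calibration lemmas of line `SketchIdeator4` (crux-ideate round 2, ideator 4: card
`Cruxes/UniformSadicTowerFour/Ideas/gaussian-thue-pell-square.md`, notes `BarrierNotes-r2-k4.md` N1) for
crux #2 `UniformSadicTowerFour` of route `IneffectiveSubspace`, re-derived and kernel-checked by the line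
lead.  Three statements are inlined throughout (no auxiliary `def`):

  `CellRaw        := ∀ ε > 0, ∃ C > 0, ∀ t m n > 0, 1 + t² = m·n⁴ → m·n⁴ < C·(t·m·n)^(1+ε)`
  `PellSquareCell := ∀ ε > 0, ∃ C > 0, ∀ t m n > 0, 1 + t² = m·n⁴ → n ≤ C·m^(1/2+ε)`
  `W₄ (QuarticRootWall) := ∀ ε > 0, ∃ C > 0, ∀ t n > 0, n⁴ ∣ t² + 1 → n³ ≤ C·t^(1+ε)`

(`W₄`: the least positive square root of `−1` modulo `n⁴` is `≥ n^(3−ε)`; trivial bound `n²`).  Contents: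

* `cellRaw_of_towerIneqFourOne` — Vojta exponent `1` on `X_4` (the crux's `K = 0` face, inlined) gives
  `CellRaw` at the tower point `x = (1,1,1,1)`, `y = (1,t,1,1)`, `z = (m,1,1,n)`;
  `cellRaw_of_uniformSadicTowerFour` (crux ⟹ `CellRaw`: `K = 0`, `S = ∅`, the bracket of `M ≠ 0` is `M`);
  `cellRaw_of_abc` (through the landed `abcGivesUniformSadic_proof`).
* `pellSquareCell_of_cellRaw` — `t² < m·n⁴` turns `CellRaw` into `n ≤ C·m^(1/2+ε)`;
  `pellSquareCell_of_uniformSadicTowerFour`.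
* `quarticRootWall_of_pellSquareCell`, `pellSquareCell_of_quarticRootWall` — the two readings are
  equivalent; hence `quarticRootWall_of_uniformSadicTowerFour` (**crux ⟹ `W₄`**: "any proof of the
  crux bounds the least square root of `−1` modulo `n⁴` from below by `n^(3−ε)`") and
  `quarticRootWall_of_abc`.

What is NOT here: no composition concluding the crux — the line is a necessary-condition map of one
cell of the `K = 0` face (card §Honest scope); see `Lines/SketchIdeator4.dead.md` in the crux directory.
The `ℤ[i]` reading (harmonic quartic Thue equations, Ljunggren's point), the `ℤ[i]` normal form
(`t + i = μ·ν⁴`) and the `K ≥ 1` reading of the cell are separate support files.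

Uses only Mathlib and the landed `UniformSadicGivesTowerFour.bracket_empty`, `abcGivesUniformSadic_proof`.
-/

-- `Summit.<Summit>.<Problem>` is the mandated summit-side namespace (CONVENTIONS §2); for the
-- single-conjunct summit `ABC` the two coincide, so the duplicate `ABC.ABC` is deliberate.
set_option linter.dupNamespace false
namespace Summit.ABC.ABC.Theorems.UniformSadicTowerFour.QuarticRootWall

open scoped BigOperators
open Summit.ABC.ABC.Theses.IneffectiveSubspace
open Summit.ABC.ABC.Theorems

/-! ## Real-exponent bookkeeping -/

/-- If `X^a < K·Y^b` with `X, K, Y ≥ 0` and `a > 0` then `X < K^(1/a)·Y^(b/a)`. [folklore] -/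
theorem lt_rpow_mul_rpow_of_rpow_lt {X K Y a b : ℝ} (hX : 0 ≤ X) (hK : 0 ≤ K) (hY : 0 ≤ Y)
    (ha : 0 < a) (h : X ^ a < K * Y ^ b) : X < K ^ (1 / a) * Y ^ (b / a) := by
  have h1 : (X ^ a) ^ (1 / a) < (K * Y ^ b) ^ (1 / a) :=
    Real.rpow_lt_rpow (by positivity) h (by positivity)
  rw [← Real.rpow_mul hX, mul_one_div_cancel ha.ne', Real.rpow_one,
    Real.mul_rpow hK (by positivity), ← Real.rpow_mul hY, mul_one_div] at h1
  exact h1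

/-- Monotonicity used repeatedly: for `1 ≤ K`, `1 ≤ Y`, exponents `p ≤ p'` (with `0 ≤ p'`) and `q ≤ q'`,
`K^p·Y^q ≤ K^p'·Y^q'`. [folklore] -/
theorem rpow_mul_rpow_le {K Y p p' q q' : ℝ} (hK : 1 ≤ K) (hY : 1 ≤ Y) (hp : p ≤ p') (hq : q ≤ q') :
    K ^ p * Y ^ q ≤ K ^ p' * Y ^ q' :=
  mul_le_mul (Real.rpow_le_rpow_of_exponent_le hK hp) (Real.rpow_le_rpow_of_exponent_le hY hq)
    (by positivity) (by positivity)

/-! ## The cell inequality from the `K = 0` face -/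

/-- **Vojta exponent `1` on `X_4` gives `CellRaw`.** If `∏ zᵢ^(i+1) < C·(∏ xᵢyᵢzᵢ)^(1+ε)` for every
positive coprime level-4 tower point (the crux's `K = 0` face, `TowerIneqAt 4 1`, inlined), then for
`1 + t² = m·n⁴` (`t, m, n > 0`) one has `m·n⁴ < C·(t·m·n)^(1+ε)`: the tower point is `x = (1,1,1,1)`,
`y = (1,t,1,1)`, `z = (m,1,1,n)` (`gcd(1, t²) = 1`). (Card §First lemma, `cellRaw_of_crux`.) [folklore] -/
theorem cellRaw_of_towerIneqFourOne
    (hT : ∀ ε : ℝ, 0 < ε → ∃ C : ℝ, 0 < C ∧ ∀ x y z : Fin 4 → ℕ, (∀ i, 0 < x i ∧ 0 < y i ∧ 0 < z i) →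
      (∏ i, x i ^ (i.val + 1)) + (∏ i, y i ^ (i.val + 1)) = ∏ i, z i ^ (i.val + 1) →
      Nat.Coprime (∏ i, x i ^ (i.val + 1)) (∏ i, y i ^ (i.val + 1)) →
      ((∏ i, z i ^ (i.val + 1) : ℕ) : ℝ) < C * ((∏ i, x i * y i * z i : ℕ) : ℝ) ^ (1 + ε)) :
    ∀ ε : ℝ, 0 < ε → ∃ C : ℝ, 0 < C ∧ ∀ t m n : ℕ, 0 < t → 0 < m → 0 < n →
      1 + t ^ 2 = m * n ^ 4 → ((m * n ^ 4 : ℕ) : ℝ) < C * ((t * m * n : ℕ) : ℝ) ^ (1 + ε) := by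
  intro ε hε
  obtain ⟨C, hC, hTow⟩ := hT ε hε
  refine ⟨C, hC, fun t m n ht hm hn hcell => ?_⟩
  have key := hTow ![1, 1, 1, 1] ![1, t, 1, 1] ![m, 1, 1, n]
    (by intro i; fin_cases i <;> simp [hm, ht, hn]) (by simpa [Fin.prod_univ_four] using hcell)
    (by simp [Fin.prod_univ_four])
  have h1 : (∏ i : Fin 4, (![m, 1, 1, n] : Fin 4 → ℕ) i ^ (i.val + 1)) = m * n ^ 4 := by
    simp [Fin.prod_univ_four]
  have h2 : (∏ i : Fin 4, (![1, 1, 1, 1] : Fin 4 → ℕ) i * (![1, t, 1, 1] : Fin 4 → ℕ) i *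
      (![m, 1, 1, n] : Fin 4 → ℕ) i) = t * m * n := by
    simp [Fin.prod_univ_four, mul_comm, mul_left_comm]
  rwa [h1, h2] at key

/-- **The crux implies `CellRaw`**: `UniformSadicTowerFour` at `K = 0`, `S = ∅` is Vojta exponent `1` on
`X_4` (the bracket of `M ≠ 0` at `S = ∅` is `M`, `UniformSadicGivesTowerFour.bracket_empty`), so
`cellRaw_of_towerIneqFourOne` applies. (Card: `cellRaw_of_crux`.) [folklore] -/
theorem cellRaw_of_uniformSadicTowerFour (hU : UniformSadicTowerFour) :
    ∀ ε : ℝ, 0 < ε → ∃ C : ℝ, 0 < C ∧ ∀ t m n : ℕ, 0 < t → 0 < m → 0 < n →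
      1 + t ^ 2 = m * n ^ 4 → ((m * n ^ 4 : ℕ) : ℝ) < C * ((t * m * n : ℕ) : ℝ) ^ (1 + ε) := by
  refine cellRaw_of_towerIneqFourOne fun ε hε => ?_
  obtain ⟨C, hC, hK⟩ := hU 0 ε hε
  refine ⟨C, hC, fun x y z hpos hsum hcop => ?_⟩
  have hM : (∏ i, x i * y i * z i) ≠ 0 :=
    (Finset.prod_pos fun i _ =>
      Nat.mul_pos (Nat.mul_pos (hpos i).1 (hpos i).2.1) (hpos i).2.2).ne'
  have key := hK ∅ (by simp) (by simp) x y z hpos hsum hcop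
  rwa [UniformSadicGivesTowerFour.bracket_empty hM] at key

/-- **`ABC ⟹ CellRaw`** (through the landed `abcGivesUniformSadic_proof : ABC → UniformSadicTowerFour`).
[folklore] -/
theorem cellRaw_of_abc (habc : ABC) :
    ∀ ε : ℝ, 0 < ε → ∃ C : ℝ, 0 < C ∧ ∀ t m n : ℕ, 0 < t → 0 < m → 0 < n →
      1 + t ^ 2 = m * n ^ 4 → ((m * n ^ 4 : ℕ) : ℝ) < C * ((t * m * n : ℕ) : ℝ) ^ (1 + ε) :=
  cellRaw_of_uniformSadicTowerFour (abcGivesUniformSadic_proof habc)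

/-! ## `CellRaw ⟹ PellSquareCell` -/

/-- **`CellRaw` implies `PellSquareCell`.** From `m·n⁴ < C·(t·m·n)^(1+δ)` and `t² < m·n⁴` one gets
`(m·n⁴)² < C²·(m³·n⁶)^(1+δ)`, i.e. `n^(2−6δ) < C²·m^(1+3δ)`; with `δ := min ε 1 / 6` this gives
`n ≤ (max C 1)²·m^(1/2+ε)`. (Card: `pellSquareCell_of_cellRaw`.) [folklore] -/
theorem pellSquareCell_of_cellRaw
    (hR : ∀ ε : ℝ, 0 < ε → ∃ C : ℝ, 0 < C ∧ ∀ t m n : ℕ, 0 < t → 0 < m → 0 < n →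
      1 + t ^ 2 = m * n ^ 4 → ((m * n ^ 4 : ℕ) : ℝ) < C * ((t * m * n : ℕ) : ℝ) ^ (1 + ε)) :
    ∀ ε : ℝ, 0 < ε → ∃ C : ℝ, 0 < C ∧ ∀ t m n : ℕ, 0 < t → 0 < m → 0 < n →
      1 + t ^ 2 = m * n ^ 4 → (n : ℝ) ≤ C * (m : ℝ) ^ ((1 : ℝ) / 2 + ε) := by
  intro ε hε
  set δ : ℝ := min ε 1 / 6 with hδdef
  have hδ0 : 0 < δ := by have := lt_min hε one_pos; positivity
  have hδ1 : δ ≤ 1 / 6 := by have := min_le_right ε 1; rw [hδdef]; linarith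
  -- the key exponent inequality `3δ(1+ε) ≤ ε`, i.e. `(1 + 2ε)(1 − 3δ) ≥ 1 + 3δ`
  have hδε : 6 * δ * (1 + ε) ≤ 2 * ε := by
    rcases le_or_gt ε 1 with h | h
    · rw [hδdef, min_eq_left h]; nlinarith
    · rw [hδdef, min_eq_right h.le]; nlinarith
  obtain ⟨C, hC, hCR⟩ := hR δ hδ0
  refine ⟨max C 1 ^ 2, by positivity, fun t m n ht hm hn hcell => ?_⟩
  have hM1 : (1 : ℝ) ≤ m := by exact_mod_cast hm
  have hN1 : (1 : ℝ) ≤ n := by exact_mod_cast hn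
  have hM0 : (0 : ℝ) < m := by positivity
  have hN0 : (0 : ℝ) < n := by positivity
  have hC1 : (1 : ℝ) ≤ max C 1 := le_max_right _ _
  have key := hCR t m n ht hm hn hcell
  push_cast at key
  -- square: `(m n⁴)² < C² ((t m n)²)^(1+δ) < C² (m³ n⁶)^(1+δ)`
  have hδ1' : 0 < 1 + δ := by linarith
  have ht2 : ((t : ℝ) * m * n) ^ 2 < (m : ℝ) ^ 3 * (n : ℝ) ^ 6 := by
    have h' : (t * m * n) ^ 2 < m ^ 3 * n ^ 6 := by
      have h5 : t ^ 2 < m * n ^ 4 := by omega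
      calc (t * m * n) ^ 2 = t ^ 2 * (m ^ 2 * n ^ 2) := by ring
        _ < m * n ^ 4 * (m ^ 2 * n ^ 2) := mul_lt_mul_of_pos_right h5 (by positivity)
        _ = m ^ 3 * n ^ 6 := by ring
    exact_mod_cast h'
  have hsq : ((m : ℝ) * (n : ℝ) ^ 4) ^ 2 < C ^ 2 * ((m : ℝ) ^ 3 * (n : ℝ) ^ 6) ^ (1 + δ) := by
    have h0 : (0 : ℝ) ≤ (m : ℝ) * (n : ℝ) ^ 4 := by positivity
    calc ((m : ℝ) * (n : ℝ) ^ 4) ^ 2 < (C * ((t : ℝ) * m * n) ^ (1 + δ)) ^ 2 := by gcongr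
      _ = C ^ 2 * ((((t : ℝ) * m * n) ^ 2) ^ (1 + δ)) := by
          rw [mul_pow, ← Real.rpow_natCast (((t : ℝ) * m * n) ^ (1 + δ)) 2,
            ← Real.rpow_mul (by positivity), mul_comm (1 + δ), Real.rpow_mul (by positivity),
            Real.rpow_natCast]
      _ < C ^ 2 * ((m : ℝ) ^ 3 * (n : ℝ) ^ 6) ^ (1 + δ) := by
          gcongr
  -- rewrite both sides as products of real powers and cancel `m² · n^(6+6δ)`
  have hL : ((m : ℝ) * (n : ℝ) ^ 4) ^ 2 = (m : ℝ) ^ (2 : ℝ) * ((n : ℝ) ^ (2 - 6 * δ) * (n : ℝ) ^ (6 + 6 * δ)) := by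
    rw [← Real.rpow_add hN0, show (2 - 6 * δ) + (6 + 6 * δ) = ((8 : ℕ) : ℝ) by push_cast; ring,
      Real.rpow_natCast, Real.rpow_two]; ring
  have hRt : ((m : ℝ) ^ 3 * (n : ℝ) ^ 6) ^ (1 + δ) = ((m : ℝ) ^ (2 : ℝ) * (m : ℝ) ^ (1 + 3 * δ)) * (n : ℝ) ^ (6 + 6 * δ) := by
    rw [Real.mul_rpow (by positivity) (by positivity), ← Real.rpow_add hM0,
      ← Real.rpow_natCast (m : ℝ) 3, ← Real.rpow_natCast (n : ℝ) 6, ← Real.rpow_mul hM0.le,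
      ← Real.rpow_mul hN0.le]
    congr 1 <;> (congr 1; push_cast; ring)
  rw [hL, hRt] at hsq
  have hpos1 : (0 : ℝ) < (m : ℝ) ^ (2 : ℝ) := by positivity
  have hpos2 : (0 : ℝ) < (n : ℝ) ^ (6 + 6 * δ) := by positivity
  have hred : (n : ℝ) ^ (2 - 6 * δ) < C ^ 2 * (m : ℝ) ^ (1 + 3 * δ) := by
    have h' : (m : ℝ) ^ (2 : ℝ) * ((n : ℝ) ^ (2 - 6 * δ) * (n : ℝ) ^ (6 + 6 * δ)) <
        (m : ℝ) ^ (2 : ℝ) * ((C ^ 2 * (m : ℝ) ^ (1 + 3 * δ)) * (n : ℝ) ^ (6 + 6 * δ)) := by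
      calc _ < C ^ 2 * ((m : ℝ) ^ (2 : ℝ) * (m : ℝ) ^ (1 + 3 * δ) * (n : ℝ) ^ (6 + 6 * δ)) := hsq
        _ = _ := by ring
    exact lt_of_mul_lt_mul_right (lt_of_mul_lt_mul_left h' hpos1.le) hpos2.le
  -- extract `n`
  have ha : (0 : ℝ) < 2 - 6 * δ := by linarith
  have hn_lt := lt_rpow_mul_rpow_of_rpow_lt hN0.le (by positivity) hM0.le ha hred
  -- compare exponents: `(C²)^(1/(2−6δ)) ≤ (max C 1)²`, `(1+3δ)/(2−6δ) ≤ 1/2 + ε`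
  have hK1 : (1 : ℝ) ≤ C ^ 2 ⊔ 1 := le_max_right _ _
  have hexpK : 1 / (2 - 6 * δ) ≤ 1 := by rw [div_le_one ha]; linarith
  have hexpY : (1 + 3 * δ) / (2 - 6 * δ) ≤ 1 / 2 + ε := by
    rw [div_le_iff₀ ha]; nlinarith
  have hC2 : C ^ 2 ≤ max C 1 ^ 2 := by gcongr; exact le_max_left _ _
  calc (n : ℝ) ≤ (C ^ 2) ^ (1 / (2 - 6 * δ)) * (m : ℝ) ^ ((1 + 3 * δ) / (2 - 6 * δ)) := hn_lt.le
    _ ≤ (max C 1 ^ 2) ^ (1 / (2 - 6 * δ)) * (m : ℝ) ^ ((1 + 3 * δ) / (2 - 6 * δ)) := by gcongr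
    _ ≤ (max C 1 ^ 2) ^ (1 : ℝ) * (m : ℝ) ^ ((1 : ℝ) / 2 + ε) :=
        rpow_mul_rpow_le (one_le_pow₀ hC1) hM1 hexpK hexpY
    _ = max C 1 ^ 2 * (m : ℝ) ^ ((1 : ℝ) / 2 + ε) := by rw [Real.rpow_one]

/-- Hence **the crux implies `PellSquareCell`**: `1 + t² = m·n⁴ ⟹ n ≤ C_ε·m^(1/2+ε)` — "if the
`√m`-coordinate of the norm-`(−1)` unit is a perfect square then the unit is `≤ m^(3/2+ε)`".
(Card: `pellSquareCell_of_crux`.) [folklore] -/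
theorem pellSquareCell_of_uniformSadicTowerFour (hU : UniformSadicTowerFour) :
    ∀ ε : ℝ, 0 < ε → ∃ C : ℝ, 0 < C ∧ ∀ t m n : ℕ, 0 < t → 0 < m → 0 < n →
      1 + t ^ 2 = m * n ^ 4 → (n : ℝ) ≤ C * (m : ℝ) ^ ((1 : ℝ) / 2 + ε) :=
  pellSquareCell_of_cellRaw (cellRaw_of_uniformSadicTowerFour hU)

/-! ## `PellSquareCell ⟺ W₄` -/

/-- **`PellSquareCell ⟹ W₄`.** If `n⁴ ∣ t² + 1` write `t² + 1 = m·n⁴`; then `n ≤ C·m^(1/2+ε')` with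
`m ≤ 2t²/n⁴` gives `n^(3+4ε') ≤ C·2^(1/2+ε')·t^(1+2ε')`, so (`ε' := ε/2`, `n ≥ 1`)
`n³ ≤ C·2^((1+ε)/2)·t^(1+ε)`. (Card: `quarticRootWall_iff_pellSquareCell`, direction ⟸.) [folklore] -/
theorem quarticRootWall_of_pellSquareCell
    (hP : ∀ ε : ℝ, 0 < ε → ∃ C : ℝ, 0 < C ∧ ∀ t m n : ℕ, 0 < t → 0 < m → 0 < n →
      1 + t ^ 2 = m * n ^ 4 → (n : ℝ) ≤ C * (m : ℝ) ^ ((1 : ℝ) / 2 + ε)) :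
    ∀ ε : ℝ, 0 < ε → ∃ C : ℝ, 0 < C ∧ ∀ t n : ℕ, 0 < t → 0 < n → n ^ 4 ∣ t ^ 2 + 1 →
      (n : ℝ) ^ 3 ≤ C * (t : ℝ) ^ (1 + ε) := by
  intro ε hε
  obtain ⟨C, hC, hCP⟩ := hP (ε / 2) (by positivity)
  refine ⟨C * (2 : ℝ) ^ ((1 + ε) / 2), by positivity, fun t n ht hn hdvd => ?_⟩
  obtain ⟨m, hm⟩ := hdvd
  have hm0 : 0 < m := by
    rcases Nat.eq_zero_or_pos m with rfl | h
    · simp at hm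
    · exact h
  have hcell : 1 + t ^ 2 = m * n ^ 4 := by rw [add_comm, hm]; ring
  have hN0 : (0 : ℝ) < n := by exact_mod_cast hn
  have hN1 : (1 : ℝ) ≤ n := by exact_mod_cast hn
  have hT0 : (0 : ℝ) < t := by exact_mod_cast ht
  have key := hCP t m n ht hm0 hn hcell
  -- `m ≤ 2 t² / n⁴`
  have hmle : (m : ℝ) ≤ 2 * (t : ℝ) ^ 2 / (n : ℝ) ^ 4 := by
    rw [le_div_iff₀ (by positivity)]
    have h' : m * n ^ 4 ≤ 2 * t ^ 2 := by
      have : 1 ≤ t ^ 2 := Nat.one_le_pow _ _ ht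
      omega
    exact_mod_cast h'
  have hε2 : 0 < (1 : ℝ) / 2 + ε / 2 := by positivity
  have h1 : (n : ℝ) ≤ C * (2 * (t : ℝ) ^ 2 / (n : ℝ) ^ 4) ^ ((1 : ℝ) / 2 + ε / 2) :=
    key.trans (by gcongr)
  -- unfold the right-hand side
  have h2 : (2 * (t : ℝ) ^ 2 / (n : ℝ) ^ 4) ^ ((1 : ℝ) / 2 + ε / 2) =
      (2 : ℝ) ^ ((1 + ε) / 2) * (t : ℝ) ^ (1 + ε) / (n : ℝ) ^ (2 + 2 * ε) := by
    rw [Real.div_rpow (by positivity) (by positivity), Real.mul_rpow (by positivity) (by positivity),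
      ← Real.rpow_natCast (t : ℝ) 2, ← Real.rpow_mul hT0.le, ← Real.rpow_natCast (n : ℝ) 4,
      ← Real.rpow_mul hN0.le]
    congr 2
    · congr 1; ring
    · push_cast; ring
    · push_cast; ring
  rw [h2, mul_div_assoc'] at h1
  rw [le_div_iff₀ (by positivity)] at h1
  -- `n³ ≤ n · n^(2+2ε)`
  calc (n : ℝ) ^ 3 = (n : ℝ) * (n : ℝ) ^ (2 : ℝ) := by rw [Real.rpow_two]; ring
    _ ≤ (n : ℝ) * (n : ℝ) ^ (2 + 2 * ε) :=
        mul_le_mul_of_nonneg_left (Real.rpow_le_rpow_of_exponent_le hN1 (by linarith)) hN0.le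
    _ ≤ C * ((2 : ℝ) ^ ((1 + ε) / 2) * (t : ℝ) ^ (1 + ε)) := h1
    _ = C * (2 : ℝ) ^ ((1 + ε) / 2) * (t : ℝ) ^ (1 + ε) := by ring

/-- **`W₄ ⟹ PellSquareCell`.** From `n³ ≤ C·t^(1+ε')` and `t² < m·n⁴`: `n⁶ ≤ C²·(t²)^(1+ε') <
C²·(m·n⁴)^(1+ε')`, i.e. `n^(2−4ε') < C²·m^(1+ε')`; with `ε' := min ε 1 / 4` this gives
`n ≤ (max C 1)²·m^(1/2+ε)`. (Card: `quarticRootWall_iff_pellSquareCell`, direction ⟹.) [folklore] -/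
theorem pellSquareCell_of_quarticRootWall
    (hW : ∀ ε : ℝ, 0 < ε → ∃ C : ℝ, 0 < C ∧ ∀ t n : ℕ, 0 < t → 0 < n → n ^ 4 ∣ t ^ 2 + 1 →
      (n : ℝ) ^ 3 ≤ C * (t : ℝ) ^ (1 + ε)) :
    ∀ ε : ℝ, 0 < ε → ∃ C : ℝ, 0 < C ∧ ∀ t m n : ℕ, 0 < t → 0 < m → 0 < n →
      1 + t ^ 2 = m * n ^ 4 → (n : ℝ) ≤ C * (m : ℝ) ^ ((1 : ℝ) / 2 + ε) := by
  intro ε hε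
  set δ : ℝ := min ε 1 / 4 with hδdef
  have hδ0 : 0 < δ := by have := lt_min hε one_pos; positivity
  have hδ1 : δ ≤ 1 / 4 := by have := min_le_right ε 1; rw [hδdef]; linarith
  have hδε : δ * (3 + 4 * ε) ≤ 2 * ε := by
    rcases le_or_gt ε 1 with h | h
    · rw [hδdef, min_eq_left h]; nlinarith
    · rw [hδdef, min_eq_right h.le]; nlinarith
  obtain ⟨C, hC, hCW⟩ := hW δ hδ0
  refine ⟨max C 1 ^ 2, by positivity, fun t m n ht hm hn hcell => ?_⟩
  have hM1 : (1 : ℝ) ≤ m := by exact_mod_cast hm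
  have hM0 : (0 : ℝ) < m := by positivity
  have hN0 : (0 : ℝ) < n := by exact_mod_cast hn
  have hT0 : (0 : ℝ) < t := by exact_mod_cast ht
  have hC1 : (1 : ℝ) ≤ max C 1 := le_max_right _ _
  have hdvd : n ^ 4 ∣ t ^ 2 + 1 := ⟨m, by rw [add_comm, hcell]; ring⟩
  have key := hCW t n ht hn hdvd
  have hδ1' : 0 < 1 + δ := by linarith
  -- `n⁶ ≤ C² (t²)^(1+δ) < C² (m n⁴)^(1+δ)`
  have ht2 : (t : ℝ) ^ 2 < (m : ℝ) * (n : ℝ) ^ 4 := by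
    have : t ^ 2 < m * n ^ 4 := by omega
    exact_mod_cast this
  have h6 : (n : ℝ) ^ 6 < C ^ 2 * ((m : ℝ) * (n : ℝ) ^ 4) ^ (1 + δ) := by
    have h0 : (0 : ℝ) ≤ (n : ℝ) ^ 3 := by positivity
    calc (n : ℝ) ^ 6 = ((n : ℝ) ^ 3) ^ 2 := by ring
      _ ≤ (C * (t : ℝ) ^ (1 + δ)) ^ 2 := by gcongr
      _ = C ^ 2 * (((t : ℝ) ^ 2) ^ (1 + δ)) := by
          rw [mul_pow, ← Real.rpow_natCast ((t : ℝ) ^ (1 + δ)) 2, ← Real.rpow_mul hT0.le,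
            mul_comm (1 + δ), ← Real.rpow_natCast (t : ℝ) 2, ← Real.rpow_mul hT0.le]
      _ < C ^ 2 * ((m : ℝ) * (n : ℝ) ^ 4) ^ (1 + δ) := by gcongr
  -- cancel `n^(4+4δ)`
  have hL : (n : ℝ) ^ 6 = (n : ℝ) ^ (2 - 4 * δ) * (n : ℝ) ^ (4 + 4 * δ) := by
    rw [← Real.rpow_add hN0, show (2 - 4 * δ) + (4 + 4 * δ) = ((6 : ℕ) : ℝ) by push_cast; ring,
      Real.rpow_natCast]
  have hRt : ((m : ℝ) * (n : ℝ) ^ 4) ^ (1 + δ) = (m : ℝ) ^ (1 + δ) * (n : ℝ) ^ (4 + 4 * δ) := by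
    rw [Real.mul_rpow (by positivity) (by positivity), ← Real.rpow_natCast (n : ℝ) 4,
      ← Real.rpow_mul hN0.le]
    congr 2; push_cast; ring
  rw [hL, hRt, ← mul_assoc] at h6
  have hpos2 : (0 : ℝ) < (n : ℝ) ^ (4 + 4 * δ) := by positivity
  have hred : (n : ℝ) ^ (2 - 4 * δ) < C ^ 2 * (m : ℝ) ^ (1 + δ) :=
    lt_of_mul_lt_mul_right h6 hpos2.le
  have ha : (0 : ℝ) < 2 - 4 * δ := by linarith
  have hn_lt := lt_rpow_mul_rpow_of_rpow_lt hN0.le (by positivity) hM0.le ha hred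
  have hexpK : 1 / (2 - 4 * δ) ≤ 1 := by rw [div_le_one ha]; linarith
  have hexpY : (1 + δ) / (2 - 4 * δ) ≤ 1 / 2 + ε := by
    rw [div_le_iff₀ ha]; nlinarith
  have hC2 : C ^ 2 ≤ max C 1 ^ 2 := by gcongr; exact le_max_left _ _
  calc (n : ℝ) ≤ (C ^ 2) ^ (1 / (2 - 4 * δ)) * (m : ℝ) ^ ((1 + δ) / (2 - 4 * δ)) := hn_lt.le
    _ ≤ (max C 1 ^ 2) ^ (1 / (2 - 4 * δ)) * (m : ℝ) ^ ((1 + δ) / (2 - 4 * δ)) := by gcongr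
    _ ≤ (max C 1 ^ 2) ^ (1 : ℝ) * (m : ℝ) ^ ((1 : ℝ) / 2 + ε) :=
        rpow_mul_rpow_le (one_le_pow₀ hC1) hM1 hexpK hexpY
    _ = max C 1 ^ 2 * (m : ℝ) ^ ((1 : ℝ) / 2 + ε) := by rw [Real.rpow_one]

/-- **The crux implies the quartic-root wall `W₄`**: under `UniformSadicTowerFour`, for every `ε > 0`
there is `C` with `n³ ≤ C·t^(1+ε)` whenever `t, n > 0` and `n⁴ ∣ t² + 1` — "any proof of the crux bounds
the least square root of `−1` modulo `n⁴` from below by `n^(3−ε)`" (card §First lemma,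
`quarticRootWall_of_crux`; BarrierNotes-r2-k4 N1: census to `10⁹` finds exactly two prime moduli with
`log t / log n < 3`, `n = 13` and `n = 18 311 141`). [folklore] -/
theorem quarticRootWall_of_uniformSadicTowerFour (hU : UniformSadicTowerFour) :
    ∀ ε : ℝ, 0 < ε → ∃ C : ℝ, 0 < C ∧ ∀ t n : ℕ, 0 < t → 0 < n → n ^ 4 ∣ t ^ 2 + 1 →
      (n : ℝ) ^ 3 ≤ C * (t : ℝ) ^ (1 + ε) :=
  quarticRootWall_of_pellSquareCell (pellSquareCell_of_uniformSadicTowerFour hU)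

/-- **`ABC ⟹ W₄`** (through `abcGivesUniformSadic_proof`). [folklore] -/
theorem quarticRootWall_of_abc (habc : ABC) :
    ∀ ε : ℝ, 0 < ε → ∃ C : ℝ, 0 < C ∧ ∀ t n : ℕ, 0 < t → 0 < n → n ^ 4 ∣ t ^ 2 + 1 →
      (n : ℝ) ^ 3 ≤ C * (t : ℝ) ^ (1 + ε) :=
  quarticRootWall_of_uniformSadicTowerFour (abcGivesUniformSadic_proof habc)

end Summit.ABC.ABC.Theorems.UniformSadicTowerFour.QuarticRootWall
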